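import Summits.BirchSwinnertonDyer.BirchSwinnertonDyer.Theorems.KolyvaginRoadThreeSchneiderTamAtThreeHeightLogNumeratorDeepRefinedCriterion
import Summits.BirchSwinnertonDyer.BirchSwinnertonDyer.Theses.KolyvaginRoadThree
import HarnessLib

/-!
# Crux `SchneiderTamAtThree` (item 19154) — THE HEIGHT IS THE LOGARITHM OF THE NUMERATOR, DEEP POINTS,
# part 9: the crux on the refined-deep numerator sub-locus (crux named by name; imports the route file)

HONEST FRAMING (cell `bsd-stepL`, seat `bsd-stepL-tam3-p2` g2, WIDTH-LEVER second lane «closed-form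
Schneider local factor at 3 … finite case table proved once»; `--supports stmt-BirchSwinnertonDyer-19154
--as helper`): THEOREMS ONLY; 0 definitions, 0 named facts, 0 sorry; nothing here proves the crux
class-wide, Schneider's conjecture or BSD — the crux stays OPEN (class-wide it is the transcendence-type
statement `Σ²_E(P) ≠ den x(P)` on every admissible point of every curve of the locus). This thin file only
names the crux; the mathematics is in the route-free deep parts 1–8.

* `regulatorNonvanishingAt_three_of_classX11b_of_num_criterion_deep'` — for `W` of class X11b at `3`,
  non-split at `3`, `3^d ∣ 3Δ` read through `3⁻¹‖1/j‖₃ ≤ 3^{−d}`, with an admissible rational point of level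
  `≥ 2` (`3⁴ ∣ den x`), `d ≤ v₃(den x)`, passing the REFINED DEEP numerator criterion
  `3^{v₃(den x)+d} ∤ c₄((num x)³ − num x) + 2(b₂b₄ − 18b₆)·den x`: `RegulatorNonvanishingAt W 3` (GZK by
  name for the rank).
* `schneiderTamAtThree_of_num_witnesses_deep'` — **the crux ⟸ one refined-deep witness per curve of the
  locus** (given GZK). This is the exact shape of what the «finite case table by Kodaira type» contributes:
  the `3`-adic height of a point of level `k ≥ 2` is the RATIONAL closed form
  `log₃ num x + ((b₂b₄ − 18b₆)/c₄)·den x/num x` to precision `3^{2k + min(2k, v₃Δ + 1)}` (parts 3b, 6), so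
  Schneider's binder at `3` holds for every curve carrying a point whose closed form is non-zero at that
  precision — on lane A's table of record (690 TRUE-OPEN classes) such a point (`Q` or `3Q`) exists in
  690/690 rows (kit j285773; Lean rows in parts 4, 8 and `…SecondOrderCert`). No bounded precision closes
  the class: `v₃(ĥ₃)` is unbounded over the locus.

References: [SteinWuthrich2013] §4.2, Conj. 4.1; [Schneider1982PadicHeightI] §1;
[KolyvaginEulerSystems1990] Thm. A; tree: deep part 7 (`…DeepRefinedCriterion`).
-/

noncomputable section

open scoped Classical
open WeierstrassCurve Literature.NumberTheory.EllipticCurves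
open Literature.NumberTheory.EllipticCurves.SteinWuthrich2013
open Literature.NumberTheory.EllipticCurves.Rank1Residual
open Summit.BirchSwinnertonDyer.Uniform.UI.O2

namespace Summit.BirchSwinnertonDyer.Rank1Residual.X11b.RegMult.HeightLogNumerator

section Crux

variable {W : WeierstrassCurve ℚ}

/-- **Schneider's binder at `3` on the refined-deep numerator sub-locus of class X11b** (given GZK by name
for rank one): class X11b at `3`, non-split at `3`, `3⁻¹‖1/j‖₃ ≤ 3^{−d}`, an admissible rational point with
`3⁴ ∣ den x`, `d ≤ v₃(den x)` and `3^{v₃(den x)+d} ∤ c₄((num x)³ − num x) + 2(b₂b₄ − 18b₆)·den x` ⟹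
`RegulatorNonvanishingAt W 3`. [cite: SteinWuthrich2013, §4.2, Conj. 4.1] [cite: KolyvaginEulerSystems1990, Thm. A] -/
theorem regulatorNonvanishingAt_three_of_classX11b_of_num_criterion_deep'
    (hGZK : rank_eq_analyticRank_of_analyticRank_le_one) (W : WeierstrassCurve ℚ) [W.IsElliptic]
    [W.IsGloballyMinimal] (hX : Summit.BirchSwinnertonDyer.Rank1Residual.ClassX11b W 3)
    (hns : ¬ W.HasSplitMultiplicativeReductionAtPrime 3)
    {x y : ℚ} {h : W.toAffine.Nonsingular x y} (hadm : W.IsAdmissible 3 (.some x y h))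
    (h4 : 4 ≤ padicValNat 3 x.den) {d : ℕ} (hd : d ≤ padicValNat 3 x.den)
    (hjd : 3⁻¹ * ‖((W.j : ℚ_[3]))⁻¹‖ ≤ (3 : ℝ) ^ (-(d : ℤ))) {N : ℤ}
    (hN : W.c₄ * ((x.num : ℚ) ^ 3 - x.num) + 2 * (W.b₂ * W.b₄ - 18 * W.b₆) * (x.den : ℚ) = (N : ℚ))
    (hcrit : ¬ ((3 : ℤ) ^ (padicValNat 3 x.den + d) ∣ N)) :
    X11b.ClassClosure.RegulatorNonvanishingAt W 3 :=
  regulatorNonvanishingAt_three_of_num_criterion_deep' hX.2.2.1 hns (by rw [(hGZK W hX.1.le).1, hX.1])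
    hadm h4 hd hjd hN hcrit

/-- **`SchneiderTamAtThree` ⟸ one REFINED-DEEP numerator witness per curve** (given GZK): if every curve
of the crux's locus (`ClassX11b W 3`, (ram), non-split at `3`, `3 ∣ ∏ c_ℓ`) has an admissible rational point
`(x, y)` of level `≥ 2` and integers `d ≤ v₃(den x)`, `N = c₄((num x)³ − num x) + 2(b₂b₄ − 18b₆)·den x`
with `3⁻¹‖1/j‖₃ ≤ 3^{−d}` and `3^{v₃(den x)+d} ∤ N`, the crux holds. CONDITIONAL on the witness hypothesis
`hwit` — a statement about rational points of infinitely many curves (true, with the point `Q` or `3Q` of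
lane A's table, on 690/690 tabulated classes, kit j285773) — recorded as the exact shape of what the
closed form by Kodaira type contributes to this crux; no bounded precision closes the class.
[cite: SteinWuthrich2013, §4.2, Conj. 4.1] [cite: KolyvaginEulerSystems1990, Thm. A] -/
theorem schneiderTamAtThree_of_num_witnesses_deep' (hGZK : rank_eq_analyticRank_of_analyticRank_le_one)
    (hwit : ∀ (W : WeierstrassCurve ℚ) [W.IsElliptic] [W.IsGloballyMinimal],
      Summit.BirchSwinnertonDyer.Rank1Residual.ClassX11b W 3 →
      Literature.NumberTheory.EllipticCurves.Rank1Residual.Ram W 3 →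
      ¬ W.HasSplitMultiplicativeReductionAtPrime 3 → 3 ∣ W.tamagawaProduct →
      ∃ (x y : ℚ) (h : W.toAffine.Nonsingular x y) (d : ℕ) (N : ℤ), W.IsAdmissible 3 (.some x y h) ∧
        4 ≤ padicValNat 3 x.den ∧ d ≤ padicValNat 3 x.den ∧
        3⁻¹ * ‖((W.j : ℚ_[3]))⁻¹‖ ≤ (3 : ℝ) ^ (-(d : ℤ)) ∧
        W.c₄ * ((x.num : ℚ) ^ 3 - x.num) + 2 * (W.b₂ * W.b₄ - 18 * W.b₆) * (x.den : ℚ) = (N : ℚ) ∧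
        ¬ ((3 : ℤ) ^ (padicValNat 3 x.den + d) ∣ N)) :
    Summit.BirchSwinnertonDyer.BirchSwinnertonDyer.Theses.KolyvaginRoadThree.SchneiderTamAtThree := by
  intro W _ _ hX hram hns htam
  obtain ⟨x, y, h, d, N, hadm, h4, hd, hjd, hN, hcrit⟩ := hwit W hX hram hns htam
  exact regulatorNonvanishingAt_three_of_classX11b_of_num_criterion_deep' hGZK W hX hns hadm h4 hd hjd hN
    hcrit

end Crux

end Summit.BirchSwinnertonDyer.Rank1Residual.X11b.RegMult.HeightLogNumerator

end
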